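import Summits.BirchSwinnertonDyer.BirchSwinnertonDyer.Theorems.SchneiderFreeAdditiveX3PoitouTateReciprocitySumHolds
import Literature.NumberTheory.EllipticCurves.GrossLMS1991.HeegnerEulerSystemCongruenceImageFree
import Literature.NumberTheory.EllipticCurves.HeegnerPointsIdentityComponent
import HarnessLib

/-!
# Crux 19715 `ErratumRoadFive.EulerHalfNotRamNoInertSetAtFive`, line `birth`: the CITABLE stub `stub_printFactsHeld`
# from TWO printed facts — its conjunct (2) is a THEOREM of the tree

Width seat `bsd-line-er5-p1-w2` g2 (cell bsd-stepL), `--supports stmt-BirchSwinnertonDyer-19715`. Theorems only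
(no definition, no named fact, no `sorry`).

The registered skeleton `Cruxes/EulerHalfNotRamNoInertSetAtFive/Lines/birth.lean` (v10 b7515075465fbade; v11 ∕ v12 of
the LEAD keep this stub VERBATIM) carries ONE by-name citable stub `stub_printFactsHeld` = (1) Gross 1991 Prop. 3.7 (2)
image-free `GrossLMS1991.prop37_2_frobeniusCongruence` ∧ (2) Milne *ADT* I Thm. 4.10 (b) ∕ Howard Thm. 2.1.11 for THE
canonical local invariant maps, `∀ K n, (LocalInvariants.canonical K n).SelmerComplement` ∧ (3) Gross 1991 §6 ∕ [GZ86 III (3.1)]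
`Gross1991_heegnerPoint_sub_ratTorsion_mem_E0`.

Conjunct (2) is, since 2026-08-28T11:03Z, an unconditional THEOREM of the tree:
`SchneiderFreeAdditiveX3.PoitouTateReduction.selmerComplement_canonical_holds (K) (n)` (cell bsd-schneider, door-c4 g18,
p626891; from the sign-free E-side reciprocity sum over the tree's Tate duality for `(Γ_K, C̄_K)`). Hence the registered
three-conjunct text follows from the TWO remaining printed facts (1) and (3):

* `selmerComplement_canonical_forall` — conjunct (2) VERBATIM, as a closed theorem;
* `printFactsHeld_of_twoPrintFacts (h37) (hE0) : <registered text of stub_printFactsHeld VERBATIM>`.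

Skeleton recipe (for the LEAD, one writer per RULING 58): replace `stub_printFactsHeld` by a two-conjunct
`stub_twoPrintFactsHeld : prop37_2_frobeniusCongruence ∧ Gross1991_heegnerPoint_sub_ratTorsion_mem_E0` and derive the old
statement as `printFactsHeld_of_twoPrintFacts hF2.1 hF2.2` (every consumer takes `type_of% @stub_printFactsHeld` unchanged).

HONEST FRAMING: a bookkeeping discharge of ONE named printed input of the line (named-fact debt of `stub_printFactsHeld` 3 → 2);
conjuncts (1) and (3) remain PRINTED facts taken by name; nothing is claimed about the crux 19715, which stays open;
BSD is proved for no curve; no summit statement is proved by this file.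

References: [cite: MilneADT2006, Ch. I, Thm. 4.10 (b)] [cite: Howard2004HeegnerKolyvagin, Thm. 2.1.11]
[cite: GrossLMS1991, Prop. 3.7 (2), §6] [cite: GrossZagier1986Heegner, III (3.1)]
-/

set_option linter.dupNamespace false

namespace Summit.BirchSwinnertonDyer.BirchSwinnertonDyer.Theorems.EulerHalfPrintFacts

open Literature.NumberTheory.EllipticCurves Literature.NumberTheory.GaloisCohomology

/-- **Conjunct (2) of `stub_printFactsHeld` is a theorem**: for every number field `K` and every level `n ≥ 1`, THE canonical
family of local invariant maps has the `SelmerComplement` property (Milne *ADT* I Thm. 4.10 (b) ∕ Howard Thm. 2.1.11) — the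
tree's `SchneiderFreeAdditiveX3.PoitouTateReduction.selmerComplement_canonical_holds`, restated in the stub's binder shape.
[cite: MilneADT2006, Ch. I, Thm. 4.10 (b)] [cite: Howard2004HeegnerKolyvagin, Thm. 2.1.11] -/
theorem selmerComplement_canonical_forall :
    ∀ (K : Type) [Field K] [NumberField K] (n : ℕ) [NeZero n],
      (LocalInvariants.canonical K n).SelmerComplement :=
  fun K _ _ n _ => SchneiderFreeAdditiveX3.PoitouTateReduction.selmerComplement_canonical_holds K n

/-- **`stub_printFactsHeld` ⟸ TWO printed facts.** The registered three-conjunct text of the citable stub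
`stub_printFactsHeld` of `Cruxes/EulerHalfNotRamNoInertSetAtFive/Lines/birth.lean` (v10 ∕ v11 ∕ v12 VERBATIM) from
(1) `GrossLMS1991.prop37_2_frobeniusCongruence` and (3) `Gross1991_heegnerPoint_sub_ratTorsion_mem_E0` alone, conjunct (2) being
`selmerComplement_canonical_forall`. CONDITIONAL on the two printed facts (hypotheses, by name); closes nothing.
[cite: GrossLMS1991, Prop. 3.7 (2), §6] [cite: MilneADT2006, Ch. I, Thm. 4.10 (b)] -/
theorem printFactsHeld_of_twoPrintFacts
    (h37 : GrossLMS1991.prop37_2_frobeniusCongruence)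
    (hE0 : Gross1991_heegnerPoint_sub_ratTorsion_mem_E0) :
    Literature.NumberTheory.EllipticCurves.GrossLMS1991.prop37_2_frobeniusCongruence ∧
    (∀ (K : Type) [Field K] [NumberField K] (n : ℕ) [NeZero n],
      (Literature.NumberTheory.GaloisCohomology.LocalInvariants.canonical K n).SelmerComplement) ∧
    Literature.NumberTheory.EllipticCurves.Gross1991_heegnerPoint_sub_ratTorsion_mem_E0 :=
  ⟨h37, selmerComplement_canonical_forall, hE0⟩

/-- **Conversely** (trivial projection, for the skeleton's bookkeeping): the registered three-conjunct text yields the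
two-conjunct one. [folklore] -/
theorem twoPrintFacts_of_printFactsHeld
    (hF : Literature.NumberTheory.EllipticCurves.GrossLMS1991.prop37_2_frobeniusCongruence ∧
      (∀ (K : Type) [Field K] [NumberField K] (n : ℕ) [NeZero n],
        (Literature.NumberTheory.GaloisCohomology.LocalInvariants.canonical K n).SelmerComplement) ∧
      Literature.NumberTheory.EllipticCurves.Gross1991_heegnerPoint_sub_ratTorsion_mem_E0) :
    GrossLMS1991.prop37_2_frobeniusCongruence ∧ Gross1991_heegnerPoint_sub_ratTorsion_mem_E0 :=
  ⟨hF.1, hF.2.2⟩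

end Summit.BirchSwinnertonDyer.BirchSwinnertonDyer.Theorems.EulerHalfPrintFacts
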